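import Summits.ValiantsHypothesis.ValiantsHypothesis.Theorems.BarrierLeverChowThinRowsTwinPeel

/-!
# Route BarrierLever — item `ChowHitsThinRowPartitionMinors` (stmt-ValiantsHypothesis-20195):
# coordinate splits of indicator-form families — product and leave-one-out factorisation

Helper file (`--supports stmt-ValiantsHypothesis-20195`; cell valiant-natproofs, rung V4, 𝒟-side of
door (c); prover seat valiant-natproofs-prover gen 11).  Closes NO item; imports only the seat's
`…ChowThinRowsTwinPeel` (no route file).  Notation (`φ⁰_V`, `B_𝒦`, `E_V`, SPAN, POS) as in
`…ChowThinRowsTwinPeelSpan`.  Companion: `…ChowThinRowsCross` (the CROSS gluing lemma and its slice).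

Content (bookkeeping for the cross lemma).  Split the column coordinates as `A ⊔ Aᶜ`; let `𝒦_A`
consist of subsets of `A` and `𝒦_B` of subsets avoiding `A` (so `𝒦_A ∩ 𝒦_B ⊆ {∅}` and `φ⁰_∅ = 1`,
`form0_empty`).  Then `B_{𝒦_A ∪ 𝒦_B} = B_{𝒦_A} · B_{𝒦_B}` (`prod_union_of_inter_subset`), the
variables of `B_{𝒦_A}` are among `{y_c : c ∈ A}` (`vars_prod_subset_of_subset`), and on squarefree
monomials the coefficients factorise through the split `W = (W ∩ A) ⊔ (W \ A)`
(`coeff_prod_mul_prod_split`, from val-np-p7's block peel `coeff_partitionExpo_mul_block`); the same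
for every leave-one-out product of the union (`coeff_looProd_union_of_mem_left/right`,
`coeff_prod_union_split`).

WHAT THIS IS NOT: bookkeeping only; nothing on items 20195 / 20172 / 19717 themselves, on crux
stmt-ValiantsHypothesis-14610, or on `VP` versus `VNP`.
-/

set_option linter.dupNamespace false

namespace Summit.ValiantsHypothesis.ValiantsHypothesis.Theorems.BarrierLever.ChowTwinPeel

open Finset MvPolynomial
open Summit.ValiantsHypothesis.ValiantsHypothesis.Theorems.BarrierLever.ChowThinAffine
  (coeff_partitionExpo_mul_block)
open Summit.ValiantsHypothesis.ValiantsHypothesis.Theorems.BarrierLever.ChowSubcube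
  (coeff_empty_prod_nat)
open Summit.ValiantsHypothesis.ValiantsHypothesis.Theorems.BarrierLever.ProductStateSums
  (castAdd_ne_natAdd partitionExpo_apply_natAdd)

variable {h : ℕ}

/-! ## 1. Products over two families meeting only in `∅`; variables of indicator products -/

/-- The indicator form of `∅` is the constant `1`. -/
theorem form0_empty :
    (C 1 + ∑ a, C ((fun (_ : Fin h) (_ : Finset (Fin h)) => (0 : ℂ)) a ∅) * X (Fin.castAdd h a) +
      ∑ c', C (if c' ∈ (∅ : Finset (Fin h)) then (1 : ℂ) else 0) * X (Fin.natAdd h c') :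
        MvPolynomial (Fin (h + h)) ℂ) = 1 := by
  have h1 : ∑ a : Fin h, C ((fun (_ : Fin h) (_ : Finset (Fin h)) => (0 : ℂ)) a ∅) *
      X (Fin.castAdd h a) = (0 : MvPolynomial (Fin (h + h)) ℂ) := by
    refine Finset.sum_eq_zero fun a _ => ?_
    simp
  have h2 : ∑ c', C (if c' ∈ (∅ : Finset (Fin h)) then (1 : ℂ) else 0) * X (Fin.natAdd h c') =
      (0 : MvPolynomial (Fin (h + h)) ℂ) := by
    refine Finset.sum_eq_zero fun c _ => ?_
    simp
  rw [h1, h2, add_zero, add_zero, C_1]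

/-- **Two families meeting at most in `∅` multiply**: `B_{𝒳 ∪ 𝒴} = B_𝒳 · B_𝒴`. -/
theorem prod_union_of_inter_subset (𝒳 𝒴 : Finset (Finset (Fin h)))
    (hint : ∀ V ∈ 𝒳, V ∈ 𝒴 → V = ∅) :
    (∏ V ∈ 𝒳 ∪ 𝒴, (C 1 + ∑ a, C ((fun (_ : Fin h) (_ : Finset (Fin h)) => (0 : ℂ)) a V) *
      X (Fin.castAdd h a) + ∑ c', C (if c' ∈ V then (1 : ℂ) else 0) * X (Fin.natAdd h c') :
        MvPolynomial (Fin (h + h)) ℂ)) =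
    (∏ V ∈ 𝒳, (C 1 + ∑ a, C ((fun (_ : Fin h) (_ : Finset (Fin h)) => (0 : ℂ)) a V) *
      X (Fin.castAdd h a) + ∑ c', C (if c' ∈ V then (1 : ℂ) else 0) * X (Fin.natAdd h c') :
        MvPolynomial (Fin (h + h)) ℂ)) *
    (∏ V ∈ 𝒴, (C 1 + ∑ a, C ((fun (_ : Fin h) (_ : Finset (Fin h)) => (0 : ℂ)) a V) *
      X (Fin.castAdd h a) + ∑ c', C (if c' ∈ V then (1 : ℂ) else 0) * X (Fin.natAdd h c') :
        MvPolynomial (Fin (h + h)) ℂ)) := by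
  classical
  rw [← Finset.prod_union_inter]
  have h1 : (∏ V ∈ 𝒳 ∩ 𝒴, (C 1 + ∑ a, C ((fun (_ : Fin h) (_ : Finset (Fin h)) => (0 : ℂ)) a V) *
      X (Fin.castAdd h a) + ∑ c', C (if c' ∈ V then (1 : ℂ) else 0) * X (Fin.natAdd h c') :
        MvPolynomial (Fin (h + h)) ℂ)) = 1 := by
    refine Finset.prod_eq_one fun V hV => ?_
    rw [Finset.mem_inter] at hV
    rw [hint V hV.1 hV.2]
    exact form0_empty
  rw [h1, mul_one]

/-- The variables of an indicator form `φ⁰_V` are among the `y_c`, `c ∈ V`. -/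
theorem vars_form0_subset (V : Finset (Fin h)) :
    (C 1 + ∑ a, C ((fun (_ : Fin h) (_ : Finset (Fin h)) => (0 : ℂ)) a V) *
      X (Fin.castAdd h a) + ∑ c', C (if c' ∈ V then (1 : ℂ) else 0) * X (Fin.natAdd h c') :
        MvPolynomial (Fin (h + h)) ℂ).vars ⊆
      (∅ : Finset (Fin h)).image (Fin.castAdd h) ∪ V.image (Fin.natAdd h) := by
  classical
  have h1 : ∑ a : Fin h, C ((fun (_ : Fin h) (_ : Finset (Fin h)) => (0 : ℂ)) a V) *
      X (Fin.castAdd h a) = (0 : MvPolynomial (Fin (h + h)) ℂ) := by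
    refine Finset.sum_eq_zero fun a _ => ?_
    simp
  rw [h1, add_zero]
  intro v hv
  rcases Finset.mem_union.mp (vars_add_subset _ _ hv) with hv1 | hv2
  · rw [vars_C] at hv1
    exact absurd hv1 (Finset.notMem_empty _)
  · have hv3 := vars_sum_subset _ _ hv2
    rw [Finset.mem_biUnion] at hv3
    obtain ⟨c', _, hc'⟩ := hv3
    by_cases hcV : c' ∈ V
    · rw [if_pos hcV, C_1, one_mul, vars_X, Finset.mem_singleton] at hc'
      rw [hc']
      exact Finset.mem_union_right _ (Finset.mem_image_of_mem _ hcV)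
    · rw [if_neg hcV, C_0, zero_mul, vars_0] at hc'
      exact absurd hc' (Finset.notMem_empty _)

/-- The variables of `B_𝒦` for a family of subsets of `A` are among the `y_c`, `c ∈ A`. -/
theorem vars_prod_subset_of_subset (𝒦 : Finset (Finset (Fin h))) (A : Finset (Fin h))
    (hA : ∀ V ∈ 𝒦, V ⊆ A) :
    (∏ V ∈ 𝒦, (C 1 + ∑ a, C ((fun (_ : Fin h) (_ : Finset (Fin h)) => (0 : ℂ)) a V) *
      X (Fin.castAdd h a) + ∑ c', C (if c' ∈ V then (1 : ℂ) else 0) * X (Fin.natAdd h c') :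
        MvPolynomial (Fin (h + h)) ℂ)).vars ⊆
      (∅ : Finset (Fin h)).image (Fin.castAdd h) ∪ A.image (Fin.natAdd h) := by
  classical
  intro v hv
  have hv' := vars_prod _ hv
  rw [Finset.mem_biUnion] at hv'
  obtain ⟨V, hV, hvV⟩ := hv'
  rcases Finset.mem_union.mp (vars_form0_subset V hvV) with h1 | h2
  · exact Finset.mem_union_left _ h1
  · rw [Finset.mem_image] at h2
    obtain ⟨c, hc, rfl⟩ := h2
    exact Finset.mem_union_right _ (Finset.mem_image_of_mem _ (hA V hV hc))

/-- **Coefficient factorisation across a coordinate split.**  If every member of `𝒦_A` lies inside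
`A` and every member of `𝒦_B` avoids `A`, then on squarefree monomials
`coeff_{y^W} (B_{𝒦_A} · B_{𝒦_B}) = coeff_{y^{W ∩ A}} B_{𝒦_A} · coeff_{y^{W \ A}} B_{𝒦_B}`
(val-np-p7's block peel). -/
theorem coeff_prod_mul_prod_split (𝒦A 𝒦B : Finset (Finset (Fin h))) (A : Finset (Fin h))
    (hA : ∀ V ∈ 𝒦A, V ⊆ A) (hB : ∀ V ∈ 𝒦B, ∀ c ∈ V, c ∉ A) (W : Finset (Fin h)) :
    coeff (∑ a ∈ (∅ : Finset (Fin h)), Finsupp.single (Fin.castAdd h a) 1 +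
        ∑ c' ∈ W, Finsupp.single (Fin.natAdd h c') 1)
      ((∏ V ∈ 𝒦A, (C 1 + ∑ a, C ((fun (_ : Fin h) (_ : Finset (Fin h)) => (0 : ℂ)) a V) *
        X (Fin.castAdd h a) + ∑ c', C (if c' ∈ V then (1 : ℂ) else 0) * X (Fin.natAdd h c') :
          MvPolynomial (Fin (h + h)) ℂ)) *
       (∏ V ∈ 𝒦B, (C 1 + ∑ a, C ((fun (_ : Fin h) (_ : Finset (Fin h)) => (0 : ℂ)) a V) *
        X (Fin.castAdd h a) + ∑ c', C (if c' ∈ V then (1 : ℂ) else 0) * X (Fin.natAdd h c') :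
          MvPolynomial (Fin (h + h)) ℂ))) =
    coeff (∑ a ∈ (∅ : Finset (Fin h)), Finsupp.single (Fin.castAdd h a) 1 +
        ∑ c' ∈ W.filter (fun c' => c' ∈ A), Finsupp.single (Fin.natAdd h c') 1)
      (∏ V ∈ 𝒦A, (C 1 + ∑ a, C ((fun (_ : Fin h) (_ : Finset (Fin h)) => (0 : ℂ)) a V) *
        X (Fin.castAdd h a) + ∑ c', C (if c' ∈ V then (1 : ℂ) else 0) * X (Fin.natAdd h c') :
          MvPolynomial (Fin (h + h)) ℂ)) *
    coeff (∑ a ∈ (∅ : Finset (Fin h)), Finsupp.single (Fin.castAdd h a) 1 +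
        ∑ c' ∈ W.filter (fun c' => c' ∉ A), Finsupp.single (Fin.natAdd h c') 1)
      (∏ V ∈ 𝒦B, (C 1 + ∑ a, C ((fun (_ : Fin h) (_ : Finset (Fin h)) => (0 : ℂ)) a V) *
        X (Fin.castAdd h a) + ∑ c', C (if c' ∈ V then (1 : ℂ) else 0) * X (Fin.natAdd h c') :
          MvPolynomial (Fin (h + h)) ℂ)) := by
  classical
  have hq : Disjoint (∏ V ∈ 𝒦B, (C 1 + ∑ a, C ((fun (_ : Fin h) (_ : Finset (Fin h)) => (0 : ℂ)) a V) *
        X (Fin.castAdd h a) + ∑ c', C (if c' ∈ V then (1 : ℂ) else 0) * X (Fin.natAdd h c') :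
          MvPolynomial (Fin (h + h)) ℂ)).vars
      ((∅ : Finset (Fin h)).image (Fin.castAdd h) ∪ A.image (Fin.natAdd h)) := by
    rw [Finset.disjoint_left]
    intro v hv hvA
    have hv' := vars_prod _ hv
    rw [Finset.mem_biUnion] at hv'
    obtain ⟨V, hV, hvV⟩ := hv'
    rcases Finset.mem_union.mp (vars_form0_subset V hvV) with h1 | h2
    · rw [Finset.image_empty] at h1
      exact Finset.notMem_empty _ h1
    · rw [Finset.mem_image] at h2
      obtain ⟨c, hc, rfl⟩ := h2
      rw [Finset.image_empty, Finset.empty_union, Finset.mem_image] at hvA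
      obtain ⟨c'', hc'', e⟩ := hvA
      rw [Fin.natAdd_injective _ _ e] at hc''
      exact hB V hV c hc hc''
  rw [coeff_partitionExpo_mul_block _ _ ∅ A (vars_prod_subset_of_subset 𝒦A A hA) hq ∅ W,
    Finset.filter_empty, Finset.filter_empty]


/-- Erasing a member that can only be `∅` does not change the product of indicator forms. -/
theorem prod_erase_of_imp_empty (𝒳 : Finset (Finset (Fin h))) (V : Finset (Fin h))
    (hV : V ∈ 𝒳 → V = ∅) :
    (∏ V ∈ 𝒳.erase V, (C 1 + ∑ a, C ((fun (_ : Fin h) (_ : Finset (Fin h)) => (0 : ℂ)) a V) *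
        X (Fin.castAdd h a) + ∑ c', C (if c' ∈ V then (1 : ℂ) else 0) * X (Fin.natAdd h c') :
          MvPolynomial (Fin (h + h)) ℂ)) =
    (∏ V ∈ 𝒳, (C 1 + ∑ a, C ((fun (_ : Fin h) (_ : Finset (Fin h)) => (0 : ℂ)) a V) *
        X (Fin.castAdd h a) + ∑ c', C (if c' ∈ V then (1 : ℂ) else 0) * X (Fin.natAdd h c') :
          MvPolynomial (Fin (h + h)) ℂ)) := by
  classical
  by_cases hmem : V ∈ 𝒳
  · rw [← Finset.mul_prod_erase 𝒳 _ hmem, hV hmem, form0_empty, one_mul]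
  · rw [Finset.erase_eq_of_notMem hmem]

/-! ## 2. CROSS families: SPAN and POS for the union of an `A`-side and an `A`-free family -/

/-- **Leave-one-out products of a split union, `A`-side member.**  For `V ∈ 𝒦_A`:
`coeff_{y^W} E_V^{𝒦_A ∪ 𝒦_B} = coeff_{y^{W ∩ A}} E_V^{𝒦_A} · coeff_{y^{W \ A}} B_{𝒦_B}`. -/
theorem coeff_looProd_union_of_mem_left (𝒦A 𝒦B : Finset (Finset (Fin h))) (A : Finset (Fin h))
    (hA : ∀ V ∈ 𝒦A, V ⊆ A) (hB : ∀ V ∈ 𝒦B, ∀ c ∈ V, c ∉ A) (V : Finset (Fin h)) (hV : V ∈ 𝒦A)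
    (W : Finset (Fin h)) :
    coeff (∑ a ∈ (∅ : Finset (Fin h)), Finsupp.single (Fin.castAdd h a) 1 +
        ∑ c' ∈ W, Finsupp.single (Fin.natAdd h c') 1)
      (∏ V' ∈ (𝒦A ∪ 𝒦B).erase V, (C 1 + ∑ a, C ((fun (_ : Fin h) (_ : Finset (Fin h)) => (0 : ℂ)) a V') *
        X (Fin.castAdd h a) + ∑ c', C (if c' ∈ V' then (1 : ℂ) else 0) * X (Fin.natAdd h c') :
          MvPolynomial (Fin (h + h)) ℂ)) =
    coeff (∑ a ∈ (∅ : Finset (Fin h)), Finsupp.single (Fin.castAdd h a) 1 +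
        ∑ c' ∈ W.filter (fun c' => c' ∈ A), Finsupp.single (Fin.natAdd h c') 1)
      (∏ V' ∈ 𝒦A.erase V, (C 1 + ∑ a, C ((fun (_ : Fin h) (_ : Finset (Fin h)) => (0 : ℂ)) a V') *
        X (Fin.castAdd h a) + ∑ c', C (if c' ∈ V' then (1 : ℂ) else 0) * X (Fin.natAdd h c') :
          MvPolynomial (Fin (h + h)) ℂ)) *
    coeff (∑ a ∈ (∅ : Finset (Fin h)), Finsupp.single (Fin.castAdd h a) 1 +
        ∑ c' ∈ W.filter (fun c' => c' ∉ A), Finsupp.single (Fin.natAdd h c') 1)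
      (∏ V' ∈ 𝒦B, (C 1 + ∑ a, C ((fun (_ : Fin h) (_ : Finset (Fin h)) => (0 : ℂ)) a V') *
        X (Fin.castAdd h a) + ∑ c', C (if c' ∈ V' then (1 : ℂ) else 0) * X (Fin.natAdd h c') :
          MvPolynomial (Fin (h + h)) ℂ)) := by
  classical
  have hVB : V ∈ 𝒦B → V = ∅ := fun hVB =>
    Finset.eq_empty_of_forall_notMem fun c hc => hB V hVB c hc (hA V hV hc)
  rw [Finset.erase_union_distrib, prod_union_of_inter_subset (𝒦A.erase V) (𝒦B.erase V)
    (fun V' hV'A hV'B => Finset.eq_empty_of_forall_notMem fun c hc =>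
      hB V' (Finset.mem_of_mem_erase hV'B) c hc (hA V' (Finset.mem_of_mem_erase hV'A) hc)),
    prod_erase_of_imp_empty 𝒦B V hVB]
  exact coeff_prod_mul_prod_split (𝒦A.erase V) 𝒦B A
    (fun V' hV' => hA V' (Finset.mem_of_mem_erase hV')) hB W

/-- **Leave-one-out products of a split union, `A`-free member.**  For `V ∈ 𝒦_B`:
`coeff_{y^W} E_V^{𝒦_A ∪ 𝒦_B} = coeff_{y^{W ∩ A}} B_{𝒦_A} · coeff_{y^{W \ A}} E_V^{𝒦_B}`. -/
theorem coeff_looProd_union_of_mem_right (𝒦A 𝒦B : Finset (Finset (Fin h))) (A : Finset (Fin h))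
    (hA : ∀ V ∈ 𝒦A, V ⊆ A) (hB : ∀ V ∈ 𝒦B, ∀ c ∈ V, c ∉ A) (V : Finset (Fin h)) (hV : V ∈ 𝒦B)
    (W : Finset (Fin h)) :
    coeff (∑ a ∈ (∅ : Finset (Fin h)), Finsupp.single (Fin.castAdd h a) 1 +
        ∑ c' ∈ W, Finsupp.single (Fin.natAdd h c') 1)
      (∏ V' ∈ (𝒦A ∪ 𝒦B).erase V, (C 1 + ∑ a, C ((fun (_ : Fin h) (_ : Finset (Fin h)) => (0 : ℂ)) a V') *
        X (Fin.castAdd h a) + ∑ c', C (if c' ∈ V' then (1 : ℂ) else 0) * X (Fin.natAdd h c') :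
          MvPolynomial (Fin (h + h)) ℂ)) =
    coeff (∑ a ∈ (∅ : Finset (Fin h)), Finsupp.single (Fin.castAdd h a) 1 +
        ∑ c' ∈ W.filter (fun c' => c' ∈ A), Finsupp.single (Fin.natAdd h c') 1)
      (∏ V' ∈ 𝒦A, (C 1 + ∑ a, C ((fun (_ : Fin h) (_ : Finset (Fin h)) => (0 : ℂ)) a V') *
        X (Fin.castAdd h a) + ∑ c', C (if c' ∈ V' then (1 : ℂ) else 0) * X (Fin.natAdd h c') :
          MvPolynomial (Fin (h + h)) ℂ)) *
    coeff (∑ a ∈ (∅ : Finset (Fin h)), Finsupp.single (Fin.castAdd h a) 1 +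
        ∑ c' ∈ W.filter (fun c' => c' ∉ A), Finsupp.single (Fin.natAdd h c') 1)
      (∏ V' ∈ 𝒦B.erase V, (C 1 + ∑ a, C ((fun (_ : Fin h) (_ : Finset (Fin h)) => (0 : ℂ)) a V') *
        X (Fin.castAdd h a) + ∑ c', C (if c' ∈ V' then (1 : ℂ) else 0) * X (Fin.natAdd h c') :
          MvPolynomial (Fin (h + h)) ℂ)) := by
  classical
  have hVA : V ∈ 𝒦A → V = ∅ := fun hVA =>
    Finset.eq_empty_of_forall_notMem fun c hc => hB V hV c hc (hA V hVA hc)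
  rw [Finset.erase_union_distrib, prod_union_of_inter_subset (𝒦A.erase V) (𝒦B.erase V)
    (fun V' hV'A hV'B => Finset.eq_empty_of_forall_notMem fun c hc =>
      hB V' (Finset.mem_of_mem_erase hV'B) c hc (hA V' (Finset.mem_of_mem_erase hV'A) hc)),
    prod_erase_of_imp_empty 𝒦A V hVA]
  exact coeff_prod_mul_prod_split 𝒦A (𝒦B.erase V) A hA
    (fun V' hV' => hB V' (Finset.mem_of_mem_erase hV')) W

/-- **The full product of a split union factorises.** -/
theorem coeff_prod_union_split (𝒦A 𝒦B : Finset (Finset (Fin h))) (A : Finset (Fin h))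
    (hA : ∀ V ∈ 𝒦A, V ⊆ A) (hB : ∀ V ∈ 𝒦B, ∀ c ∈ V, c ∉ A) (W : Finset (Fin h)) :
    coeff (∑ a ∈ (∅ : Finset (Fin h)), Finsupp.single (Fin.castAdd h a) 1 +
        ∑ c' ∈ W, Finsupp.single (Fin.natAdd h c') 1)
      (∏ V ∈ 𝒦A ∪ 𝒦B, (C 1 + ∑ a, C ((fun (_ : Fin h) (_ : Finset (Fin h)) => (0 : ℂ)) a V) *
        X (Fin.castAdd h a) + ∑ c', C (if c' ∈ V then (1 : ℂ) else 0) * X (Fin.natAdd h c') :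
          MvPolynomial (Fin (h + h)) ℂ)) =
    coeff (∑ a ∈ (∅ : Finset (Fin h)), Finsupp.single (Fin.castAdd h a) 1 +
        ∑ c' ∈ W.filter (fun c' => c' ∈ A), Finsupp.single (Fin.natAdd h c') 1)
      (∏ V ∈ 𝒦A, (C 1 + ∑ a, C ((fun (_ : Fin h) (_ : Finset (Fin h)) => (0 : ℂ)) a V) *
        X (Fin.castAdd h a) + ∑ c', C (if c' ∈ V then (1 : ℂ) else 0) * X (Fin.natAdd h c') :
          MvPolynomial (Fin (h + h)) ℂ)) *
    coeff (∑ a ∈ (∅ : Finset (Fin h)), Finsupp.single (Fin.castAdd h a) 1 +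
        ∑ c' ∈ W.filter (fun c' => c' ∉ A), Finsupp.single (Fin.natAdd h c') 1)
      (∏ V ∈ 𝒦B, (C 1 + ∑ a, C ((fun (_ : Fin h) (_ : Finset (Fin h)) => (0 : ℂ)) a V) *
        X (Fin.castAdd h a) + ∑ c', C (if c' ∈ V then (1 : ℂ) else 0) * X (Fin.natAdd h c') :
          MvPolynomial (Fin (h + h)) ℂ)) := by
  classical
  rw [prod_union_of_inter_subset 𝒦A 𝒦B (fun V hVA hVB =>
    Finset.eq_empty_of_forall_notMem fun c hc => hB V hVB c hc (hA V hVA hc))]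
  exact coeff_prod_mul_prod_split 𝒦A 𝒦B A hA hB W

end Summit.ValiantsHypothesis.ValiantsHypothesis.Theorems.BarrierLever.ChowTwinPeel
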